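import Literature.InformationTheory.Entropy.QuantumLeftoverHashingSmooth
import Literature.InformationTheory.StateDiscrimination.FuchsVanDeGraaf
import HarnessLib

/-!
# Leftover hashing against quantum side information, V: smoothing with the PURIFIED-distance
# ball — `Δ ≤ 2ε + ½ √(2^{ℓ − H^ε_min(X|E)_ρ})` over the tree's `smoothCondMinEntropy`

Fifth file of the `QuantumLeftoverHash` chain (`…Toolkit` → `…Collision` →
`QuantumLeftoverHashing` → `…Smooth` → this). Everything here is PROVED; no named fact, no
`sorry`.

## Sources (read on the page)

* [cite: TomamichelEtAl2010, Theorem 6] (held text `paper:arxiv-1002.2436`, chunk p0009): «for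
  any `ε ≥ 0`, `d_u(Z|FE)_ρ ≤ ε + ½ √(2^{ℓ − H^ε_min(X|E)_ρ})`», `H^ε_min` smoothed over the
  PURIFIED-distance ball — the smoothing convention of the tree's `smoothCondMinEntropy`
  ([cite: Tomamichel2015, §6.2.1 Definition (ε-ball)],
  [cite: LiuEtAl2025CertifiedRandomnessAmplification, SI Definition 29]).
* [cite: Renner2005, Corollary 5.6.1] (held text `paper:arxiv-quant-ph_0512258`, chunk p0056):
  the `d`-form `d ≤ 2ε + 2^{−(H^ε_min − ℓ)/2}` with a TRACE-norm ball, typed pointwise in the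
  smoothing state as the tree's `distFromUniform_le_smooth` (file IV).
* [cite: Tomamichel2015, §3.4 Lemma (Δ ≤ P ≤ √(2Δ − Δ²))] (held text `paper:arxiv-1504.00233`,
  chunk p0028): `Δ(ρ,τ) ≤ P(ρ,τ)` for sub-normalized states — the tree's
  `FuchsVanDeGraaf.half_cqTrNorm_add_le_purifiedDistance`
  (`Literature/InformationTheory/StateDiscrimination/FuchsVanDeGraaf.lean`).

## What is typed and proved

* §11 `trNorm_neg`, `cqTrNormDist_comm`; `cqTrNormDist_le_of_mem_smoothingBall` — RADIUS
  CONVERSION: `ρ̄ ∈ B^ε(ρ)` (purified, cq, sub-normalized; the tree's `smoothingBall`) ⇒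
  `‖ρ_XE − ρ̄_XE‖₁ + |tr ρ − tr ρ̄| ≤ 2ε`.
* §12 `distFromUniform_le_of_mem_smoothingBall` (pointwise) and
  **`distFromUniform_le_smoothCondMinEntropy`**: for a sub-normalized cq `ρ_XE`, `ε ≥ 0`, a
  two-universal family keyed by `K ≠ ∅`, `|Z| = 2^ℓ`:
  `E_k ½ Σ_z ‖ρ_E^{[h_k,z]} − 2^{−ℓ}ρ_E‖₁ ≤ 2ε + ½ √(2^{ℓ − H^ε_min(X|E)_ρ})` with the tree's
  `smoothCondMinEntropy ε ρ = sSup (H_min '' B^ε(ρ))` — NO finiteness hypothesis on the supremum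
  (whenever the left side exceeds `2ε`, the pointwise bound itself forces an explicit upper bound
  on the ball's min-entropies, so `csSup_le` applies; otherwise the claim is trivial).
* §13 `distFromUniform_toeplitz_le_smooth` — the Toeplitz family over `𝔽₂` (the deployed
  extractor, [cite: LiuEtAl2025CertifiedRandomness, SM §III.F]):
  `≤ 2ε + ½ √(2^{m − H^ε_min(X|E)_ρ})`.

CONSTANTS (honest): `½` and the exponent `(ℓ − H^ε_min)/2` are the printed ones of TSSR11
eq. (17) / Theorem 6; the smoothing cost here is `2ε`, not TSSR11's `ε`: `distFromUniform` is
(½ of) Renner's `d(ρ_{F(X)FE}|FE)` with the marginal `ρ_{FE}` FIXED, whose perturbation costs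
`‖ρ − ρ̄‖₁ ≤ 2P(ρ̄,ρ) ≤ 2ε` (file IV + Fuchs–van de Graaf), whereas TSSR11's `d_u` minimises over
`σ_{FE}` (their Definition 3) and moves by `P` only. TODO(general form): the `σ`-minimised `d_u`
with `+ ε`; `δ`-almost two-universal families ([cite: TomamichelEtAl2010, Theorem 7]).

HONEST FRAMING. An extractor inequality GIVEN smooth min-entropy; models no protocol, adversary or
device and certifies no entropy by itself; nothing here proves or refutes any quantum-advantage
claim; BQP vs BPP untouched.
-/

noncomputable section

namespace Literature.InformationTheory.Entropy

open Matrix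
open scoped ComplexOrder MatrixOrder
open Literature.InformationTheory.StateDiscrimination.FuchsVanDeGraaf
  (half_cqTrNorm_add_le_purifiedDistance)

namespace QuantumLeftoverHash

variable {e : Type*} [Fintype e] [DecidableEq e]
variable {X : Type*} [Fintype X] [DecidableEq X] {γ : Type*} [Fintype γ] [DecidableEq γ]
  {κ : Type*}

/-! ### §11 From the purified-distance ball to the trace-norm radius -/

/-- `‖−N‖₁ = ‖N‖₁` for Hermitian `N`. [cite: Renner2005, Definition 3.2.1 (the trace-norm ball;
plumbing)] -/
theorem trNorm_neg {N : Matrix e e ℂ} (hN : N.IsHermitian) : trNorm (-N) = trNorm N :=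
  le_antisymm (trNorm_neg_le hN) (by simpa using trNorm_neg_le hN.neg)

omit [Fintype γ] [DecidableEq γ] [DecidableEq X] in
/-- The cq trace distance is symmetric (for Hermitian blocks).
[cite: Renner2005, Definition 3.2.1] -/
theorem cqTrNormDist_comm {ρ ρ' : X → Matrix e e ℂ} (hρ : ∀ x, (ρ x).IsHermitian)
    (hρ' : ∀ x, (ρ' x).IsHermitian) : cqTrNormDist ρ ρ' = cqTrNormDist ρ' ρ := by
  unfold cqTrNormDist
  refine Finset.sum_congr rfl fun x _ => ?_
  rw [← neg_sub, trNorm_neg ((hρ' x).sub (hρ x))]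

omit [Fintype γ] [DecidableEq γ] in
/-- **Radius conversion.** A member `ρ̄` of the purified-distance ball `B^ε(ρ)` of the tree's
`smoothCondMinEntropy` ([cite: Tomamichel2015, §6.2.1 Definition (ε-ball)]) is within TRACE-NORM
distance `‖ρ_XE − ρ̄_XE‖₁ + |tr ρ − tr ρ̄| ≤ 2ε` of `ρ` — the generalized Fuchs–van de Graaf
inequality
`Δ ≤ P` [cite: Tomamichel2015, §3.4 Lemma (Δ ≤ P ≤ √(2Δ − Δ²))] for cq states
(`FuchsVanDeGraaf.half_cqTrNorm_add_le_purifiedDistance`). -/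
theorem cqTrNormDist_le_of_mem_smoothingBall {ε : ℝ} {ρ σ : X → Matrix e e ℂ}
    (hρ : IsSubnormalizedCQ ρ) (hσ : σ ∈ smoothingBall ε ρ) :
    cqTrNormDist ρ σ + |cqTrace ρ - cqTrace σ| ≤ 2 * ε := by
  have h := half_cqTrNorm_add_le_purifiedDistance hσ.1 hρ
  rw [cqTrNormDist_comm (fun x => (hρ.1 x).1) (fun x => (hσ.1.1 x).1), abs_sub_comm]
  unfold cqTrNormDist
  linarith [hσ.2]

/-! ### §12 Leftover hashing with purified-distance smoothing -/

/-- **Leftover hashing, smoothed over the purified-distance ball — pointwise form.** For a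
sub-normalized cq `ρ`, any `ρ̄ ∈ B^ε(ρ)` (purified distance, cq, sub-normalized), a two-universal
family keyed by `K ≠ ∅` and `|Z| = 2^ℓ`:
`E_k ½ Σ_z ‖ρ_E^{[h_k,z]} − 2^{−ℓ}ρ_E‖₁ ≤ 2ε + ½ √(2^{ℓ − H_min(X|E)_ρ̄})`
(`distFromUniform_le_smooth` + the radius conversion `‖ρ − ρ̄‖₁ ≤ 2P(ρ̄, ρ) ≤ 2ε`).
[cite: Renner2005, Corollary 5.6.1] [cite: TomamichelEtAl2010, Theorem 6]
[cite: Tomamichel2015, §3.4 Lemma (Δ ≤ P)] -/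
theorem distFromUniform_le_of_mem_smoothingBall [Nonempty γ] {ε : ℝ} {ρ σ : X → Matrix e e ℂ}
    (hρ : IsSubnormalizedCQ ρ) (hσ : σ ∈ smoothingBall ε ρ) {K : Finset κ} (hK : K.Nonempty)
    {h : κ → X → γ}
    (hU : ∀ x x', x ≠ x' → (K.filter fun k => h k x = h k x').card * Fintype.card γ ≤ K.card)
    {ℓ : ℕ} (hγ : Fintype.card γ = 2 ^ ℓ) :
    distFromUniform ρ K h ≤
      2 * ε + 2⁻¹ * Real.sqrt ((2 : ℝ) ^ ((ℓ : ℝ) - condMinEntropy σ)) := by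
  have h1 := distFromUniform_le_smooth hρ.1 hσ.1 hK hU hγ (h := h)
  have h2 := cqTrNormDist_le_of_mem_smoothingBall hρ hσ
  linarith [abs_nonneg (cqTrace ρ - cqTrace σ)]

/-- **Leftover hashing against quantum side information with PURIFIED-distance smoothing** (the
smoothing convention of [cite: TomamichelEtAl2010, Theorem 6] and of the tree's
`smoothCondMinEntropy`, [cite: Tomamichel2015, §6.2.2 Definition (smooth min-entropy)]): for a
sub-normalized cq state `ρ_XE`, `ε ≥ 0`, a two-universal family keyed by `K ≠ ∅` and `|Z| = 2^ℓ`,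
`E_k ½ Σ_z ‖ρ_E^{[h_k,z]} − 2^{−ℓ}ρ_E‖₁ ≤ 2ε + ½ √(2^{ℓ − H^ε_min(X|E)_ρ})`.
CONSTANTS: `½` and the exponent `(ℓ − H^ε_min)/2` are the printed ones; the smoothing cost is `2ε`
(Renner's `d`-form perturbation `‖ρ − ρ̄‖₁ ≤ 2P ≤ 2ε`, [cite: Renner2005, Corollary 5.6.1]), not
the `ε` of TSSR11's `σ`-minimised distance `d_u` (their Definition 3) — `distFromUniform` fixes the
marginal `ρ_{KE}` (TODO(general form): `d_u` with the `σ_{FE}`-minimum gives `+ ε`). No finiteness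
hypothesis on the supremum is needed: if `H^ε_min` were `+∞`-like (junk `sSup`), the displayed
bound is derived from an explicit upper bound on the ball's min-entropies forced by the pointwise
form. [cite: TomamichelEtAl2010, Theorem 6] [cite: Renner2005, Corollary 5.6.1] -/
theorem distFromUniform_le_smoothCondMinEntropy [Nonempty γ] {ε : ℝ} (hε : 0 ≤ ε)
    {ρ : X → Matrix e e ℂ} (hρ : IsSubnormalizedCQ ρ) {K : Finset κ} (hK : K.Nonempty)
    {h : κ → X → γ}
    (hU : ∀ x x', x ≠ x' → (K.filter fun k => h k x = h k x').card * Fintype.card γ ≤ K.card)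
    {ℓ : ℕ} (hγ : Fintype.card γ = 2 ^ ℓ) :
    distFromUniform ρ K h ≤
      2 * ε + 2⁻¹ * Real.sqrt ((2 : ℝ) ^ ((ℓ : ℝ) - smoothCondMinEntropy ε ρ)) := by
  set c : ℝ := distFromUniform ρ K h - 2 * ε with hc
  -- pointwise bound on the ball
  have hpt : ∀ σ ∈ smoothingBall ε ρ,
      c ≤ 2⁻¹ * Real.sqrt ((2 : ℝ) ^ ((ℓ : ℝ) - condMinEntropy σ)) := fun σ hσ => by
    have := distFromUniform_le_of_mem_smoothingBall hρ hσ hK hU hγ (h := h)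
    rw [hc]; linarith
  rcases le_or_gt c 0 with hc0 | hc0
  · -- trivial case
    have : 0 ≤ 2⁻¹ * Real.sqrt ((2 : ℝ) ^ ((ℓ : ℝ) - smoothCondMinEntropy ε ρ)) := by positivity
    rw [hc] at hc0; linarith
  · -- every min-entropy on the ball is ≤ U := ℓ − log₂(4c²)
    set U : ℝ := (ℓ : ℝ) - Real.logb 2 ((2 * c) ^ 2) with hU'
    have h4c : 0 < (2 * c) ^ 2 := by positivity
    have hbound : ∀ σ ∈ smoothingBall ε ρ, condMinEntropy σ ≤ U := fun σ hσ => by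
      have h1 := hpt σ hσ
      have h2 : 2 * c ≤ Real.sqrt ((2 : ℝ) ^ ((ℓ : ℝ) - condMinEntropy σ)) := by linarith
      have h3 : (2 * c) ^ 2 ≤ (2 : ℝ) ^ ((ℓ : ℝ) - condMinEntropy σ) := by
        calc (2 * c) ^ 2 ≤ (Real.sqrt ((2 : ℝ) ^ ((ℓ : ℝ) - condMinEntropy σ))) ^ 2 :=
              pow_le_pow_left₀ (by linarith) h2 2
          _ = (2 : ℝ) ^ ((ℓ : ℝ) - condMinEntropy σ) := Real.sq_sqrt (by positivity)
      have h4 : Real.logb 2 ((2 * c) ^ 2) ≤ (ℓ : ℝ) - condMinEntropy σ := by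
        have := Real.logb_le_logb_of_le one_lt_two h4c h3
        rwa [Real.logb_rpow two_pos (by norm_num)] at this
      rw [hU']; linarith
    have hne : (condMinEntropy '' smoothingBall ε ρ).Nonempty :=
      ⟨condMinEntropy ρ, ρ, self_mem_smoothingBall hε hρ, rfl⟩
    have hsup : smoothCondMinEntropy ε ρ ≤ U := by
      refine csSup_le hne ?_
      rintro _ ⟨σ, hσ, rfl⟩
      exact hbound σ hσ
    -- evaluate the bound at U
    have hmono : Real.sqrt ((2 : ℝ) ^ ((ℓ : ℝ) - U)) ≤
        Real.sqrt ((2 : ℝ) ^ ((ℓ : ℝ) - smoothCondMinEntropy ε ρ)) :=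
      Real.sqrt_le_sqrt (Real.rpow_le_rpow_of_exponent_le one_le_two (by linarith))
    have hval : Real.sqrt ((2 : ℝ) ^ ((ℓ : ℝ) - U)) = 2 * c := by
      rw [hU', sub_sub_cancel, Real.rpow_logb two_pos (by norm_num) h4c,
        Real.sqrt_sq (by linarith)]
    rw [hval] at hmono
    rw [hc] at hmono
    linarith

/-! ### §13 Application: Toeplitz hashing over `𝔽₂` with purified smoothing -/

section Toeplitz

open Literature.Computability.Cryptography.LeftoverHash (toeplitz toeplitz_universal)

variable {n m : ℕ}

/-- **Quantum-proof Toeplitz hashing, smooth form.** For a sub-normalized cq state on `X = 𝔽₂ⁿ`,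
`ε ≥ 0` and the Toeplitz family keyed by all `y ∈ 𝔽₂^{m+n−1}`:
`E_y ½ Σ_z ‖ρ_E^{[T_y,z]} − 2^{−m}ρ_E‖₁ ≤ 2ε + ½ √(2^{m − H^ε_min(X|E)_ρ})` — the extractor step of
the certified-randomness deployments with the smoothing convention of their entropy theorems
(purified distance). [cite: TomamichelEtAl2010, Theorem 6 with §4.2]
[cite: LiuEtAl2025CertifiedRandomness, SM §III.F (Toeplitz extractor, quantum-proof by [TSSR11])] -/
theorem distFromUniform_toeplitz_le_smooth [NeZero (m + n - 1)] {ε : ℝ} (hε : 0 ≤ ε)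
    {ρ : (Fin n → ZMod 2) → Matrix e e ℂ} (hρ : IsSubnormalizedCQ ρ) :
    distFromUniform ρ (Finset.univ : Finset (Fin (m + n - 1) → ZMod 2))
        (fun y x => (toeplitz (m := m) y).mulVec x) ≤
      2 * ε + 2⁻¹ * Real.sqrt ((2 : ℝ) ^ ((m : ℝ) - smoothCondMinEntropy ε ρ)) := by
  refine distFromUniform_le_smoothCondMinEntropy hε hρ Finset.univ_nonempty
    (fun x x' hx => ?_) ?_
  · exact (toeplitz_universal (m := m) hx).le.trans (by rw [Finset.card_univ])
  · rw [Fintype.card_fun, ZMod.card, Fintype.card_fin]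

end Toeplitz

end QuantumLeftoverHash

end Literature.InformationTheory.Entropy
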